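import Mathlib
import Summits.NavierStokesRegularity.NavierStokesRegularity.Theorems.FilamentSkeletonRssSelectionBoxRJRungChiArc
import Summits.NavierStokesRegularity.NavierStokesRegularity.Theorems.FilamentSkeletonRssSelectionBoxRJRungTruePartnerZero

/-!
# Route `FilamentSkeletonRss` · crux `SelectionBoxRJ` (stmt-NavierStokesRegularity-21220) — RUNG 2 with clause 11 proper,
# χ-PARAMETRIC FORM

Lane `ns-filament-19175-p1` (g7); helper file `--supports stmt-NavierStokesRegularity-21220`, route-independent.

`truePartnerArc_zero_chi`: χ-parametric restatement of `…RungTruePartnerZero.truePartnerArc_zero` (same proof, built on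
`truePartnerArc_rung_chi`): for `0 < Rb ≤ 1/500`, `Γ ≥ exp(Rb⁻²)`, `0 < η ≤ 7/(Γ log Γ)` and ANY continuous admissible
cut-off `χ` (plateau `|t| ≤ (11/10)Rb√(Γ log Γ)`, support `|t| ≤ (6/5)Rb√(Γ log Γ)`, values in `[0,1]`), the true-partner
cut-off local-induction arc exists with all R2 clauses, `f` and `w` differentiable, `w` strictly increasing on `(−∞, 0]`,
EXACTLY ONE stagnation zero on `ℝ`, located in `(−(9/20)√Γ, −(7/20)√Γ)`, and `8/5 ≤ w′(c₀) ≤ 7/2`.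

HONEST FRAMING.  Self-induction still LIA-modelled; MODEL-side bookkeeping for a HYPOTHETICAL filament box; NOT an instance
of `SelectionBoxRJ`; nothing here is a claim about Navier–Stokes regularity or blow-up.
-/

set_option linter.dupNamespace false -- `Theorems.…Theorems`-style path/namespace repetition is the tree convention

noncomputable section

namespace Summit.NavierStokesRegularity.NavierStokesRegularity.Theorems

open Set Function Filter MeasureTheory Real Metric
open Literature.Analysis.FluidPDE
open scoped InnerProductSpace Topology

namespace SelectionBoxRJRung

/-- **RUNG 2 with clause 11 proper, χ-parametric form.**  See the module docstring. [folklore] -/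
theorem truePartnerArc_zero_chi {Γ Rb η : ℝ} (hRb0 : 0 < Rb) (hRb : Rb ≤ 1 / 500) (hΓ : Real.exp (1 / Rb ^ 2) ≤ Γ)
    (hη0 : 0 < η) (hη : η * (Γ * Real.log Γ) ≤ 7) (χ : ℝ → ℝ) (hχc : Continuous χ)
    (hχ1 : ∀ t, |t| ≤ 11 / 10 * (Rb * Real.sqrt (Γ * Real.log Γ)) → χ t = 1)
    (hχ0 : ∀ t, 6 / 5 * (Rb * Real.sqrt (Γ * Real.log Γ)) ≤ |t| → χ t = 0) (hχ01 : ∀ t, 0 ≤ χ t ∧ χ t ≤ 1) :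
    ∃ (x : ℝ → EuclideanSpace ℝ (Fin 3)) (f : ℝ → EuclideanSpace ℝ (Fin 3)) (w : ℝ → ℝ) (c₀ : ℝ),
      -- the TRUE partner forcing along `x` and the nonlocal cut-off local-induction equation
      ((∀ t, f t = (Γ * 4 / (4 * Real.pi)) • ∫ σ : ℝ,
          ((‖x t - ((2 * ⟪x σ, EuclideanSpace.single 2 1⟫_ℝ) • (EuclideanSpace.single (2 : Fin 3) (1 : ℝ)) - x σ)‖ ^ 2
              + 1) ^ (3 / 2 : ℝ))⁻¹ •
            cross (deriv (fun u => (2 * ⟪x u, EuclideanSpace.single 2 1⟫_ℝ) •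
                (EuclideanSpace.single (2 : Fin 3) (1 : ℝ)) - x u) σ)
              (x t - ((2 * ⟪x σ, EuclideanSpace.single 2 1⟫_ℝ) • (EuclideanSpace.single (2 : Fin 3) (1 : ℝ)) - x σ))) ∧
        ContDiff ℝ 2 x ∧ x 0 = WithLp.toLp 2 ![Real.sqrt Γ / 5, 0, 0] ∧
        deriv x 0 = WithLp.toLp 2 ![0, (Real.sqrt 2)⁻¹, (Real.sqrt 2)⁻¹] ∧ (∀ t, ‖deriv x t‖ = 1) ∧
        (∀ t, iteratedDeriv 2 x t = (η * χ t) • cross (deriv x t)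
          ((1 / 2 : ℝ) • x t - (21 / 5 : ℝ) • cross (EuclideanSpace.single 2 1) (x t) + f t))) ∧
      -- near-straightness, curvature (clause 2), straight arms
      ((∀ t, ‖deriv x t - WithLp.toLp 2 ![0, (Real.sqrt 2)⁻¹, (Real.sqrt 2)⁻¹]‖ ≤ 1 / 3000) ∧
        (∀ t, ‖iteratedDeriv 2 x t‖ * Real.sqrt Γ ≤ 1) ∧
        (∀ t, 6 / 5 * (Rb * Real.sqrt (Γ * Real.log Γ)) ≤ |t| → iteratedDeriv 2 x t = 0)) ∧
      -- radial growth, properness, chord–arc, separation from the partner `R_π ∘ x` (clause 3)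
      ((∀ t, 2999 / 3000 * |t| ≤ ‖x t‖) ∧ Tendsto (fun t => ‖x t‖) (cocompact ℝ) atTop ∧
        (∀ τ σ, 1 / 2 * |τ - σ| ≤ ‖x τ - x σ‖) ∧
        (∀ τ σ, 39 / 100 * Real.sqrt Γ ≤
          ‖x τ - ((2 * ⟪x σ, EuclideanSpace.single 2 1⟫_ℝ) • (EuclideanSpace.single (2 : Fin 3) (1 : ℝ)) - x σ)‖)) ∧
      -- the slip against the TRUE partner field and MODEL TANGENCY on the ball
      ((∀ t, w t = ⟪deriv x t,
          ((1 / 2 : ℝ) • x t - (21 / 5 : ℝ) • cross (EuclideanSpace.single 2 1) (x t)) + f t⟫_ℝ) ∧ Continuous w ∧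
        (∀ t, ‖x t‖ ≤ Rb * Real.sqrt (Γ * Real.log Γ) →
          ((1 / 2 : ℝ) • x t - (21 / 5 : ℝ) • cross (EuclideanSpace.single 2 1) (x t)) + f t +
              η⁻¹ • cross (deriv x t) (iteratedDeriv 2 x t) = w t • deriv x t)) ∧
      -- the stagnation zero at `C⁰` level: signs, existence and location, waist (9), tilt (10), no zero on `[0, ∞)`
      (w (-(9 / 20) * Real.sqrt Γ) < 0 ∧ 0 < w (-(7 / 20) * Real.sqrt Γ) ∧ w c₀ = 0 ∧
        -(9 / 20) * Real.sqrt Γ < c₀ ∧ c₀ < -(7 / 20) * Real.sqrt Γ ∧ ‖x c₀‖ ≤ 1 / 2 * Real.sqrt Γ ∧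
        |⟪deriv x c₀, EuclideanSpace.single 2 1⟫_ℝ| ≤ 1 - 1 / 5 ∧ (∀ t, 0 ≤ t → 0 < w t)) ∧
      -- CLAUSE 11 PROPER: `f` and `w` differentiable, `w` strictly increasing on `(−∞, 0]`, the zero is UNIQUE on `ℝ`,
      -- and the slope at it lies in the supercritical window `[8/5, 7/2]`
      (Differentiable ℝ f ∧ Differentiable ℝ w ∧ StrictMonoOn w (Iic 0) ∧ (∀ τ, w τ = 0 → τ = c₀) ∧
        8 / 5 ≤ deriv w c₀ ∧ deriv w c₀ ≤ 7 / 2) := by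
  obtain ⟨hΓ4, -, -, -, -, -⟩ := picard_constants hRb0 hRb hΓ hη0 hη
  have hΓ0 : 0 < Γ := by linarith [show (0:ℝ) < 10 ^ 4 by norm_num]
  obtain ⟨x, f, w, c₀, ⟨hf, hxc, hx0, hx0', hxu, hxode⟩, ⟨hnear, hcurv, harm⟩, h3, ⟨hw, hwc, htan⟩,
    ⟨hneg, hpos, hc₀, hc1, hc2, hwaist, htilt, hposR⟩⟩ := truePartnerArc_rung_chi hRb0 hRb hΓ hη0 hη χ hχc hχ1 hχ0 hχ01
  have hx1 : ContDiff ℝ 1 x := hxc.of_le (by norm_num)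
  -- the frozen forcing, `C⁰` and `C¹` closeness
  set U : ℝ → EuclideanSpace ℝ (Fin 3) := fun t => (2 * Γ / Real.pi / (4 * Γ / 25 + 1 + t ^ 2)) •
      ((2 * Real.sqrt Γ / 5) • (WithLp.toLp 2 ![0, (Real.sqrt 2)⁻¹, (Real.sqrt 2)⁻¹] : EuclideanSpace ℝ (Fin 3)) -
        t • WithLp.toLp 2 ![(1:ℝ), 0, 0]) with hUdef
  have hU : ∀ t, U t = (2 * Γ / Real.pi / (4 * Γ / 25 + 1 + t ^ 2)) •
      ((2 * Real.sqrt Γ / 5) • (WithLp.toLp 2 ![0, (Real.sqrt 2)⁻¹, (Real.sqrt 2)⁻¹] : EuclideanSpace ℝ (Fin 3)) -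
        t • WithLp.toLp 2 ![(1:ℝ), 0, 0]) := fun t => rfl
  have hf0 : ∀ t, ‖f t - U t‖ ≤ 28 * (1 / 3000) * Real.sqrt Γ := fun t => by
    rw [hf t]; exact partnerField_sub_U_le (θ := 1 / 3000) hΓ0 (by norm_num) (by norm_num) U hU hx1 hxu hx0 hnear t
  obtain ⟨hfd, hf1⟩ := partnerField_deriv_sub_le (θ := 1 / 3000) hΓ0 (by norm_num) (by norm_num) U hU hx1 hxu hx0
    hnear f hf
  have hf1' : ∀ t, ‖deriv f t - deriv U t‖ ≤ 710 * (1 / 3000) := hf1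
  -- the wide zero package
  obtain ⟨hwd, ⟨c₁, hc₁, huniq⟩, hall⟩ := slip_zero_package' (θ := 1 / 3000) (ε₀ := 28 * (1 / 3000))
    (ε₁ := 710 * (1 / 3000)) (c := fun t => η * χ t) hΓ4 (by norm_num) (by norm_num) (by norm_num) (by norm_num)
    U hU hxc hxu hx0 hnear hxode hfd hf0 hf1' w hw
  have hc₀₁ : c₀ = c₁ := huniq c₀ hc₀
  obtain ⟨-, -, -, -, hmono, hsl1, hsl2⟩ := hall c₀ hc₀
  exact ⟨x, f, w, c₀, ⟨hf, hxc, hx0, hx0', hxu, hxode⟩, ⟨hnear, hcurv, harm⟩, h3, ⟨hw, hwc, htan⟩,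
    ⟨hneg, hpos, hc₀, hc1, hc2, hwaist, htilt, hposR⟩,
    ⟨hfd, hwd, hmono, fun τ hτ => (huniq τ hτ).trans hc₀₁.symm, hsl1, hsl2⟩⟩

end SelectionBoxRJRung

end Summit.NavierStokesRegularity.NavierStokesRegularity.Theorems
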